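import Mathlib
import Literature.RingTheory.MvPolynomial.IdealDegreeSemicontinuity

/-!
# LEMMA R in general: `rank U(θ) = |𝒜|` at ANY root `θ` of the minimal polynomial of `t`, in ANY field, certifies `rank U(t) = |𝒜|`

Helper file for crux `stmt-CriticalPhenomena-4575` (`NoHeavyLowerTail`, route `PercNearOneGluingNoHeavy`), new-inequality factory
seat `prim-ineq-gen-3` (gen 30).  Everything here is PROVED; no definitions.  Imports Mathlib and ONE Literature lemma
(`Literature.RingTheory.MvPolynomial.exists_submatrix_isUnit_of_linearIndependent_rows`: independent rows over a field have an
invertible maximal column-submatrix).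

Notation (memo `run/shared/lean/prim/prim-ineq-gen-3/CONJECTURE-P2F2.md`): the PENCIL rows of a finite family `𝒜` at `t` are
`A ↦ (E ↦ [E ⊆ A] + t [E ∩ A = ∅])` over the difference family `E ∈ 𝒜 \\ 𝒜`; the MS pencil conjecture (C0) says they are
linearly independent for every complex `t ≠ ±1`.  Gens 28–29 proved LEMMA R_p ("a finite certificate `rank_F U(θ) = |𝒜|` over a
finite field `F ∋ θ` transfers to characteristic `0`") degree by degree — `…QuadraticReduction`, `…CubicReduction`,
`…QuarticReduction` — by a `p`-adic descent on the integer coordinates of a dependency, which needs the reduction `f̄` of the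
minimal polynomial `f` of `t` to be IRREDUCIBLE modulo `p` (an inert prime); `ζ₁₂` (`Φ₁₂` is reducible modulo every prime) and
`ζ₈` were left open as 'the `O_K` / DVR version'.

This file replaces the descent by the MAXIMAL-MINOR argument, which needs nothing: if the rows of `U(θ)` are independent over `F`,
some maximal minor `Δ(X) ∈ ℤ[X]` of the polynomial pencil `Z + X·Y` has `Δ(θ) ≠ 0`; if the rows of `U(t)` were dependent over `K`
then `Δ(t) = 0`, so the minimal polynomial `f` of `t` divides `Δ` in `ℤ[X]` (`ℤ` is integrally closed:
`minpoly.isIntegrallyClosed_dvd`), and `f(θ) = 0` gives `Δ(θ) = 0`.  So ANY root `θ` of `f` in ANY field — a root of any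
irreducible factor of `f̄`, of any multiplicity — carries the certificate.

* `linearIndependent_rows_map_of_ker_le` — ★ rank does not drop under specialization: `M` a matrix over a commutative ring `R`,
  `ψ : R →+* K`, `φ : R →+* F` to fields with `ker ψ ≤ ker φ`; rows of `φ(M)` independent ⟹ rows of `ψ(M)` independent.
* `linearIndependent_pencil_of_specialization` — ★★ if every `q ∈ ℤ[X]` with `q(t) = 0` has `q(θ) = 0`, independence of the
  pencil rows at `θ ∈ F` implies independence at `t ∈ K` (any fields, any characteristics).
* `linearIndependent_pencil_of_root_of_minpoly` — ★★★ LEMMA R, general form: `t` integral over `ℤ` in characteristic `0`, `θ` a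
  root of `minpoly ℤ t` in any field.
* `linearIndependent_pencil_of_irreducible` — the same with a user-supplied monic irreducible `f ∈ ℤ[X]`, `f(t) = 0`, `f(θ) = 0`.
* `linearIndependent_pencil_primitiveRoot_of_cyclotomic_root` — `t` a primitive `n`-th root of unity, `θ` a root of `Φ_n` in `F`.
* `linearIndependent_pencil_twelfthRoot_of_charTwo` — ★ `ζ₁₂`: `θ² + θ + 1 = 0` in characteristic `2` (`θ = ω ∈ 𝔽₄`, a root of
  `Φ₁₂ ≡ Φ₃²`); so the golden certificate `rank_{𝔽₄} U(ω) = |𝒜|` of `…GoldenCharTwo` ALSO yields (C0) at the primitive twelfth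
  roots of unity (`t⁴ = t² − 1`) — the first class of the CONJECTURE-P2F2 §3 table with no inert prime.
* `linearIndependent_pencil_eighthRoot_of_charThree` — ★ `ζ₈`: `θ⁴ + 1 = 0` in characteristic `3` (an element of order `8` of
  `𝔽₉`) certifies the primitive eighth roots of unity.
Consequence for the programme: CONJECTURE CR(2) at `ω` (no `𝔽₄`-eigenvalue, memo §2) now covers every unit class whose minimal
polynomial has `ω` as a root modulo `2` (golden, `φ²`, `√21`-class, `ζ₃`, `ζ₆`, `ζ₁₂`, `k5cubicB`, …), irreducible or not.
(prim-ineq-gen-3 gen 30, 2026-08-26.)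
-/

namespace Summit.CriticalPhenomena.PercolationContinuityZ3.Theorems

namespace OrderedDifferences

open Finset Polynomial
open scoped FinsetFamily

/-- **Rank does not drop under specialization.**  Let `M` be a matrix over a commutative ring `R`, `ψ : R →+* K` and
`φ : R →+* F` ring maps to fields with `ker ψ ≤ ker φ` (so `φ` is a specialization of the image of `ψ`).  If the rows of `φ(M)` are
linearly independent over `F`, then the rows of `ψ(M)` are linearly independent over `K`.  [An invertible maximal minor of `φ(M)` is
`φ` of a minor of `M`, which is therefore not killed by `ψ`.] -/
theorem linearIndependent_rows_map_of_ker_le {m n R F K : Type*} [Fintype m] [Fintype n] [DecidableEq m]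
    [CommRing R] [Field F] [Field K] (φ : R →+* F) (ψ : R →+* K) (hker : ∀ r : R, ψ r = 0 → φ r = 0)
    (M : Matrix m n R) (hF : LinearIndependent F (M.map φ).row) : LinearIndependent K (M.map ψ).row := by
  classical
  obtain ⟨c, hc⟩ := Literature.RingTheory.MvPolynomial.exists_submatrix_isUnit_of_linearIndependent_rows _ hF
  have hdetF : φ (M.submatrix id c).det ≠ 0 := by
    rw [RingHom.map_det, RingHom.mapMatrix_apply]
    exact ((Matrix.isUnit_iff_isUnit_det _).mp hc).ne_zero
  have hdetK : ((M.map ψ).submatrix id c).det ≠ 0 := by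
    intro h0
    apply hdetF
    apply hker
    rw [RingHom.map_det, RingHom.mapMatrix_apply]
    exact h0
  have hunitK : IsUnit ((M.map ψ).submatrix id c) := by
    rw [Matrix.isUnit_iff_isUnit_det]
    exact isUnit_iff_ne_zero.mpr hdetK
  have hrowsK := Matrix.linearIndependent_rows_iff_isUnit.mpr hunitK
  have hrow : ((M.map ψ).submatrix id c).row = (LinearMap.funLeft K K c) ∘ (M.map ψ).row := by
    funext i j
    rfl
  rw [hrow] at hrowsK
  exact hrowsK.of_comp _

variable {α : Type*} [DecidableEq α]

/-- The rows of the INTEGER-POLYNOMIAL pencil `[E ⊆ A] + X [E ∩ A = ∅]` evaluated at `s` are the pencil rows at `s`. -/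
private theorem pencilPoly_map_row (𝒜 : Finset (Finset α)) {L : Type*} [Field L] (s : L) :
    ((Matrix.of fun (A : 𝒜) (E : (𝒜 \\ 𝒜 : Finset (Finset α))) =>
      ((if (E : Finset α) ⊆ (A : Finset α) then 1 else 0) + X * (if Disjoint (E : Finset α) (A : Finset α) then 1 else 0) :
        ℤ[X])).map (eval₂RingHom (algebraMap ℤ L) s)).row =
      fun A : 𝒜 => fun E : (𝒜 \\ 𝒜 : Finset (Finset α)) =>
        (if (E : Finset α) ⊆ (A : Finset α) then (1 : L) else 0) +
          s * (if Disjoint (E : Finset α) (A : Finset α) then (1 : L) else 0) := by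
  funext A E
  simp only [Matrix.row, Matrix.map_apply, Matrix.of_apply, coe_eval₂RingHom, eval₂_add, eval₂_mul, eval₂_X]
  congr 1
  · split_ifs <;> simp
  · congr 1
    split_ifs <;> simp

/-- **The pencil under specialization.**  If every integer polynomial vanishing at `t ∈ K` vanishes at `θ ∈ F`, then linear
independence of the pencil rows of `𝒜` at `θ` over `F` implies linear independence of the pencil rows at `t` over `K`. -/
theorem linearIndependent_pencil_of_specialization (𝒜 : Finset (Finset α))
    {K : Type*} [Field K] {t : K} {F : Type*} [Field F] {θ : F}
    (hspec : ∀ q : ℤ[X], aeval t q = 0 → aeval θ q = 0)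
    (hF : LinearIndependent F (fun A : 𝒜 => fun E : (𝒜 \\ 𝒜 : Finset (Finset α)) =>
      (if (E : Finset α) ⊆ (A : Finset α) then (1 : F) else 0) +
        θ * (if Disjoint (E : Finset α) (A : Finset α) then (1 : F) else 0))) :
    LinearIndependent K (fun A : 𝒜 => fun E : (𝒜 \\ 𝒜 : Finset (Finset α)) =>
      (if (E : Finset α) ⊆ (A : Finset α) then (1 : K) else 0) +
        t * (if Disjoint (E : Finset α) (A : Finset α) then (1 : K) else 0)) := by
  classical
  have hF' : LinearIndependent F ((Matrix.of fun (A : 𝒜) (E : (𝒜 \\ 𝒜 : Finset (Finset α))) =>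
      ((if (E : Finset α) ⊆ (A : Finset α) then 1 else 0) + X * (if Disjoint (E : Finset α) (A : Finset α) then 1 else 0) :
        ℤ[X])).map (eval₂RingHom (algebraMap ℤ F) θ)).row := by
    rw [pencilPoly_map_row 𝒜 θ]
    exact hF
  have hker : ∀ q : ℤ[X], eval₂RingHom (algebraMap ℤ K) t q = 0 → eval₂RingHom (algebraMap ℤ F) θ q = 0 := by
    intro q hq
    rw [coe_eval₂RingHom, ← aeval_def] at hq ⊢
    exact hspec q hq
  have hK := linearIndependent_rows_map_of_ker_le (K := K) (eval₂RingHom (algebraMap ℤ F) θ)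
    (eval₂RingHom (algebraMap ℤ K) t) hker _ hF'
  rw [pencilPoly_map_row 𝒜 t] at hK
  exact hK

/-- **LEMMA R, general form.**  Let `t` be integral over `ℤ` in a field `K` of characteristic `0`, and let `θ` be a root of the
minimal polynomial of `t` in ANY field `F` (any characteristic; the reduction of the minimal polynomial may well be reducible).  If the
pencil rows of `𝒜` at `θ` are linearly independent over `F`, then the pencil rows at `t` are linearly independent over `K`. -/
theorem linearIndependent_pencil_of_root_of_minpoly (𝒜 : Finset (Finset α))
    {K : Type*} [Field K] [CharZero K] {t : K} (hint : IsIntegral ℤ t)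
    {F : Type*} [Field F] {θ : F} (hθ : aeval θ (minpoly ℤ t) = 0)
    (hF : LinearIndependent F (fun A : 𝒜 => fun E : (𝒜 \\ 𝒜 : Finset (Finset α)) =>
      (if (E : Finset α) ⊆ (A : Finset α) then (1 : F) else 0) +
        θ * (if Disjoint (E : Finset α) (A : Finset α) then (1 : F) else 0))) :
    LinearIndependent K (fun A : 𝒜 => fun E : (𝒜 \\ 𝒜 : Finset (Finset α)) =>
      (if (E : Finset α) ⊆ (A : Finset α) then (1 : K) else 0) +
        t * (if Disjoint (E : Finset α) (A : Finset α) then (1 : K) else 0)) := by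
  refine linearIndependent_pencil_of_specialization 𝒜 (fun q hq => ?_) hF
  obtain ⟨r, hr⟩ := minpoly.isIntegrallyClosed_dvd hint hq
  rw [hr, map_mul, hθ, zero_mul]

/-- **LEMMA R for a monic irreducible integer polynomial.**  `f ∈ ℤ[X]` monic and irreducible with `f(t) = 0` in characteristic
`0` and `f(θ) = 0` in any field `F`: independence of the pencil rows at `θ` implies independence at `t`. -/
theorem linearIndependent_pencil_of_irreducible (𝒜 : Finset (Finset α)) (f : ℤ[X]) (hmonic : f.Monic) (hirr : Irreducible f)
    {K : Type*} [Field K] [CharZero K] {t : K} (ht : aeval t f = 0)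
    {F : Type*} [Field F] {θ : F} (hθ : aeval θ f = 0)
    (hF : LinearIndependent F (fun A : 𝒜 => fun E : (𝒜 \\ 𝒜 : Finset (Finset α)) =>
      (if (E : Finset α) ⊆ (A : Finset α) then (1 : F) else 0) +
        θ * (if Disjoint (E : Finset α) (A : Finset α) then (1 : F) else 0))) :
    LinearIndependent K (fun A : 𝒜 => fun E : (𝒜 \\ 𝒜 : Finset (Finset α)) =>
      (if (E : Finset α) ⊆ (A : Finset α) then (1 : K) else 0) +
        t * (if Disjoint (E : Finset α) (A : Finset α) then (1 : K) else 0)) := by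
  have hint : IsIntegral ℤ t := ⟨f, hmonic, by simpa [aeval_def] using ht⟩
  refine linearIndependent_pencil_of_root_of_minpoly 𝒜 hint ?_ hF
  -- `minpoly ℤ t` divides `f`, hence is a unit multiple of it
  obtain ⟨r, hr⟩ := minpoly.isIntegrallyClosed_dvd hint ht
  have hunit : IsUnit r := by
    rcases hirr.isUnit_or_isUnit hr with hu | hu
    · exact absurd hu (minpoly.not_isUnit ℤ t)
    · exact hu
  obtain ⟨u, hu⟩ := hunit
  have e : minpoly ℤ t = f * ↑u⁻¹ := by
    rw [hr, ← hu, mul_assoc, Units.mul_inv, mul_one]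
  rw [e, map_mul, hθ, zero_mul]

/-- **Roots of unity.**  `t` a primitive `n`-th root of unity in characteristic `0`, `θ` a root of the `n`-th cyclotomic polynomial in
any field `F`: independence of the pencil rows at `θ` implies independence at `t`. -/
theorem linearIndependent_pencil_primitiveRoot_of_cyclotomic_root (𝒜 : Finset (Finset α)) {n : ℕ} (hn : 0 < n)
    {K : Type*} [Field K] [CharZero K] {t : K} (ht : IsPrimitiveRoot t n)
    {F : Type*} [Field F] {θ : F} (hθ : (cyclotomic n F).IsRoot θ)
    (hF : LinearIndependent F (fun A : 𝒜 => fun E : (𝒜 \\ 𝒜 : Finset (Finset α)) =>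
      (if (E : Finset α) ⊆ (A : Finset α) then (1 : F) else 0) +
        θ * (if Disjoint (E : Finset α) (A : Finset α) then (1 : F) else 0))) :
    LinearIndependent K (fun A : 𝒜 => fun E : (𝒜 \\ 𝒜 : Finset (Finset α)) =>
      (if (E : Finset α) ⊆ (A : Finset α) then (1 : K) else 0) +
        t * (if Disjoint (E : Finset α) (A : Finset α) then (1 : K) else 0)) := by
  refine linearIndependent_pencil_of_root_of_minpoly 𝒜 (ht.isIntegral hn) ?_ hF
  rw [← cyclotomic_eq_minpoly ht hn, aeval_def, eval₂_eq_eval_map, map_cyclotomic]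
  exact hθ

/-- **`ζ₁₂` over `𝔽₄`.**  `Φ₁₂ ≡ (X² + X + 1)² (mod 2)` is reducible modulo every prime, so no 'inert prime' certificate exists; but a
root `θ` of `X² + X + 1` in characteristic `2` (a primitive cube root of unity `ω ∈ 𝔽₄`) IS a root of `Φ₁₂`, so `rank_{𝔽₄} U(ω) = |𝒜|`
certifies the pencil at every primitive twelfth root of unity `t` (`t⁴ = t² − 1`) in characteristic `0` — the same certificate that
handles the golden ratio (`…GoldenCharTwo`). -/
theorem linearIndependent_pencil_twelfthRoot_of_charTwo (𝒜 : Finset (Finset α))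
    {F : Type*} [Field F] [CharP F 2] {θ : F} (hθ : θ * θ + θ + 1 = 0)
    (hF : LinearIndependent F (fun A : 𝒜 => fun E : (𝒜 \\ 𝒜 : Finset (Finset α)) =>
      (if (E : Finset α) ⊆ (A : Finset α) then (1 : F) else 0) +
        θ * (if Disjoint (E : Finset α) (A : Finset α) then (1 : F) else 0)))
    {K : Type*} [Field K] [CharZero K] {t : K} (ht : IsPrimitiveRoot t 12) :
    LinearIndependent K (fun A : 𝒜 => fun E : (𝒜 \\ 𝒜 : Finset (Finset α)) =>
      (if (E : Finset α) ⊆ (A : Finset α) then (1 : K) else 0) +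
        t * (if Disjoint (E : Finset α) (A : Finset α) then (1 : K) else 0)) := by
  refine linearIndependent_pencil_primitiveRoot_of_cyclotomic_root 𝒜 (by norm_num) ht ?_ hF
  haveI : Fact (Nat.Prime 2) := ⟨Nat.prime_two⟩
  have h12 : cyclotomic 12 F = (X ^ 2 + X + 1) ^ 2 := by
    have h := cyclotomic_mul_prime_pow_eq F (p := 2) (m := 3) (by norm_num) (k := 2) (by norm_num)
    norm_num at h
    exact h
  rw [h12, IsRoot]
  simp only [eval_add, eval_pow, eval_X, eval_one]
  rw [pow_two θ, hθ]
  ring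

/-- **`ζ₈` over `𝔽₉`.**  `Φ₈ = X⁴ + 1` splits into two quadratics modulo every odd prime (and is `(X+1)⁴` mod 2); a root `θ` of
`X⁴ + 1` in characteristic `3` (an element of order `8` in `𝔽₉`) certifies the pencil at every primitive eighth root of unity in
characteristic `0`. -/
theorem linearIndependent_pencil_eighthRoot_of_charThree (𝒜 : Finset (Finset α))
    {F : Type*} [Field F] [CharP F 3] {θ : F} (hθ : θ ^ 4 + 1 = 0)
    (hF : LinearIndependent F (fun A : 𝒜 => fun E : (𝒜 \\ 𝒜 : Finset (Finset α)) =>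
      (if (E : Finset α) ⊆ (A : Finset α) then (1 : F) else 0) +
        θ * (if Disjoint (E : Finset α) (A : Finset α) then (1 : F) else 0)))
    {K : Type*} [Field K] [CharZero K] {t : K} (ht : IsPrimitiveRoot t 8) :
    LinearIndependent K (fun A : 𝒜 => fun E : (𝒜 \\ 𝒜 : Finset (Finset α)) =>
      (if (E : Finset α) ⊆ (A : Finset α) then (1 : K) else 0) +
        t * (if Disjoint (E : Finset α) (A : Finset α) then (1 : K) else 0)) := by
  refine linearIndependent_pencil_primitiveRoot_of_cyclotomic_root 𝒜 (by norm_num) ht ?_ hF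
  have h8 : cyclotomic 8 F = X ^ 4 + 1 := by
    have h := cyclotomic_prime_pow_eq_geom_sum (R := F) (p := 2) (n := 2) Nat.prime_two
    norm_num [Finset.sum_range_succ] at h
    rw [h]
    try ring
  rw [h8, IsRoot]
  simp only [eval_add, eval_pow, eval_X, eval_one]
  exact hθ

end OrderedDifferences

end Summit.CriticalPhenomena.PercolationContinuityZ3.Theorems
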